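import Summits.Langlands.Langlands.Theses.RationalPeriodQuarter
import Literature.NumberTheory.Automorphic.BLZPeriodCocycle

/-!
# `PeriodClassNontrivialQuarter` from the Bruggeman–Lewis–Zagier facts (bridge)

Route `Langlands/RationalPeriodQuarter`, crux `PeriodClassNontrivialQuarter` (stmt-Langlands-2805, binder `h₂`
of the route's `closes`): a weight-0, eigenvalue-1/4 cusp form `u` on `Γ₁(N)` whose Lewis–Zagier period cocycle
`γ ↦ lzCocycle u γ` is, off finite sets, the coboundary `f|γ - f` of a semi-analytic `f` vanishes identically.

The Literature file `Literature/NumberTheory/Automorphic/BLZPeriodCocycle.lean` proves exactly this consequence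
(`eq_zero_of_lewisZagierCocycle_semiAnalytic_coboundary`) for every determinant-one discrete `Γ ≤ GL₂(ℝ)` with
infinite boundary orbits, every `0 < Re s < 1` and every base point, from the three named facts
`BruggemanLewisZagier2015_cocycle_analytic` (p. 29), `BruggemanLewisZagier2015_prop_5_1` (Proposition 5.1) and
`BruggemanLewisZagier2015_singularities_invariants` (§13.1) of [BruggemanLewisZagier2015] (doi:10.1090/memo/1118) —
each of which is discharged in the tree (`…_holds` in `BLZPeriodCocycleAnalyticityProofs`,
`BLZPeriodCocycleInjectivity`, `BLZPeriodCocycleSingularitiesProofs`).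

This file is the BRIDGE from the route's self-contained objects to the Literature model at `s = 1/2`, `z₀ = i`,
`Γ = Γ₁(N) ↦ (Γ₁(N)).map (mapGL ℝ) ≤ GL₂(ℝ)`:

* §1 the comparison subgroup: determinant one, discrete (Mathlib: finite index ⇒ arithmetic ⇒ discrete), all
  boundary orbits infinite (`T = (1 1; 0 1)`, `L = (1 0; N 1) ∈ Γ₁(N)` and `hasInfiniteBoundaryOrbits_of_unipotents`),
  and a quarter cusp form is an invariant `λ_{1/2}`-eigenfunction for it;
* §2 `slashHalf γ = lineSlash (1/2) (mapGL ℝ γ)` (`lineSlash_one_half`);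
* §3 `lzCocycle u γ = lewisZagierCocycle (1/2) i u (mapGL ℝ γ)`: the two integrands agree on the segment
  `w(τ) = (1-τ)·γ⁻¹ i + τ·i ⊂ ℍ` because `R(t; w)^{1/2} = √(Im w)/‖w - t‖` on `Im w ≥ 0`
  (`hypPoissonKernelCpow_one_half`), hence also their real Fréchet derivatives agree at `w` (`Im w > 0` is open);
* §4 the crux from the three facts (`periodClassNontrivialQuarter_of_BLZ`), and the regularity of the typed cocycle
  from the first fact alone (`cocycleAnalyticity_of_BLZ`, piece A of the g39 node `AnalyticCoboundarySplit`).

The unconditional theorem `periodClassNontrivialQuarter : PeriodClassNontrivialQuarter` is the one-line application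
to the three `_holds` theorems (sibling file `RationalPeriodQuarterPeriodClassNontrivial.lean`, which imports the proof
modules).

References: [BruggemanLewisZagier2015] R. Bruggeman, J. Lewis, D. Zagier, *Period functions for Maass wave forms and
cohomology*, Mem. AMS 237 no. 1118 (2015), doi:10.1090/memo/1118 — (2.1) p. 11, (5.5a) p. 29, Prop. 5.1 p. 30, §13.1 p. 83.
-/

noncomputable section

set_option linter.dupNamespace false

namespace Summit.Langlands.Langlands.Theorems

open Literature.NumberTheory.Automorphic
open scoped MatrixGroups Topology ComplexConjugate

/-! ## §1 The comparison subgroup `Γ₁(N) ≤ GL₂(ℝ)` -/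

/-- Entries of the image of `γ ∈ SL₂(ℤ)` in `GL₂(ℝ)`. [folklore] -/
theorem mapGL_real_apply (γ : SL(2, ℤ)) (i j : Fin 2) :
    ((Matrix.SpecialLinearGroup.mapGL ℝ γ : GL (Fin 2) ℝ) i j : ℝ) = (((γ : Matrix (Fin 2) (Fin 2) ℤ) i j : ℤ) : ℝ) :=
  rfl

/-- The action of `SL₂(ℤ)` on `ℍ` factors through `mapGL ℝ`. [folklore] -/
theorem sl_smul_eq_mapGL_smul (γ : SL(2, ℤ)) (z : UpperHalfPlane) :
    γ • z = (Matrix.SpecialLinearGroup.mapGL ℝ γ : GL (Fin 2) ℝ) • z :=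
  rfl

/-- `T = (1 1; 0 1) ∈ Γ₁(N)`. [folklore] -/
theorem upper_unipotent_mem_Gamma1 (N : ℕ) :
    ∃ γ ∈ CongruenceSubgroup.Gamma1 N, ((γ : Matrix (Fin 2) (Fin 2) ℤ) 0 0 : ℤ) = 1 ∧
      ((γ : Matrix (Fin 2) (Fin 2) ℤ) 0 1 : ℤ) = 1 ∧ ((γ : Matrix (Fin 2) (Fin 2) ℤ) 1 0 : ℤ) = 0 ∧
      ((γ : Matrix (Fin 2) (Fin 2) ℤ) 1 1 : ℤ) = 1 := by
  refine ⟨⟨!![1, 1; 0, 1], by simp [Matrix.det_fin_two_of]⟩, ?_, rfl, rfl, rfl, rfl⟩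
  rw [CongruenceSubgroup.Gamma1_mem]
  simp

/-- `L = (1 0; N 1) ∈ Γ₁(N)`. [folklore] -/
theorem lower_unipotent_mem_Gamma1 (N : ℕ) :
    ∃ γ ∈ CongruenceSubgroup.Gamma1 N, ((γ : Matrix (Fin 2) (Fin 2) ℤ) 0 0 : ℤ) = 1 ∧
      ((γ : Matrix (Fin 2) (Fin 2) ℤ) 0 1 : ℤ) = 0 ∧ ((γ : Matrix (Fin 2) (Fin 2) ℤ) 1 0 : ℤ) = N ∧
      ((γ : Matrix (Fin 2) (Fin 2) ℤ) 1 1 : ℤ) = 1 := by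
  refine ⟨⟨!![1, 0; (N : ℤ), 1], by simp [Matrix.det_fin_two_of]⟩, ?_, rfl, rfl, rfl, rfl⟩
  rw [CongruenceSubgroup.Gamma1_mem]
  simp

/-- All `Γ₁(N)`-orbits in `P¹(ℝ)` are infinite (`N ≥ 1`). [cite: BruggemanLewisZagier2015, §13.1 p. 83] -/
theorem hasInfiniteBoundaryOrbits_Gamma1 {N : ℕ} (hN : 0 < N) :
    HasInfiniteBoundaryOrbits ((CongruenceSubgroup.Gamma1 N).map (Matrix.SpecialLinearGroup.mapGL ℝ)) := by
  obtain ⟨T, hT, t00, t01, t10, t11⟩ := upper_unipotent_mem_Gamma1 N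
  obtain ⟨L, hL, l00, l01, l10, l11⟩ := lower_unipotent_mem_Gamma1 N
  refine hasInfiniteBoundaryOrbits_of_unipotents (h := 1) (h' := (N : ℝ)) one_ne_zero
    (by exact_mod_cast hN.ne') ?_ ?_
  · refine ⟨Matrix.SpecialLinearGroup.mapGL ℝ T, Subgroup.mem_map_of_mem _ hT, ?_, ?_, ?_, ?_⟩ <;>
      simp only [mapGL_real_apply, t00, t01, t10, t11, Int.cast_one, Int.cast_zero]
  · refine ⟨Matrix.SpecialLinearGroup.mapGL ℝ L, Subgroup.mem_map_of_mem _ hL, ?_, ?_, ?_, ?_⟩ <;>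
      simp only [mapGL_real_apply, l00, l01, l10, l11, Int.cast_one, Int.cast_zero, Int.cast_natCast]

/-- The image of `Γ₁(N)` in `GL₂(ℝ)` is discrete (finite index in `SL₂(ℤ)` ⇒ arithmetic ⇒ discrete). [folklore] -/
theorem discreteTopology_Gamma1 {N : ℕ} (hN : 0 < N) :
    DiscreteTopology ((CongruenceSubgroup.Gamma1 N).map (Matrix.SpecialLinearGroup.mapGL ℝ)) := by
  haveI : NeZero N := ⟨hN.ne'⟩
  infer_instance

/-- The image of `Γ₁(N)` in `GL₂(ℝ)` has determinant one. [folklore] -/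
theorem hasDetOne_Gamma1 (N : ℕ) :
    ((CongruenceSubgroup.Gamma1 N).map (Matrix.SpecialLinearGroup.mapGL ℝ)).HasDetOne := by
  infer_instance

/-- A quarter cusp form on `Γ₁(N)` (C², `Γ₁(N)`-invariant, `Δu = ¼u`) is an invariant `λ_{1/2}`-eigenfunction of the
image of `Γ₁(N)` in `GL₂(ℝ)` in the sense of `BLZPeriodCocycle`. [cite: BruggemanLewisZagier2015, (1.1) p. 8] -/
theorem isInvariantEigenfunction_half_of_quarter {N : ℕ} {u : UpperHalfPlane → ℂ} (hC2 : IsC2 u)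
    (hinv : ∀ γ ∈ CongruenceSubgroup.Gamma1 N, ∀ z : UpperHalfPlane, u (γ • z) = u z)
    (heig : ∀ z : UpperHalfPlane, hypLaplacian u z + (1 / 4 : ℂ) * u z = 0) :
    IsInvariantEigenfunction ((CongruenceSubgroup.Gamma1 N).map (Matrix.SpecialLinearGroup.mapGL ℝ)) (1 / 2) u := by
  refine ⟨hC2, fun z => ?_, fun γ' hγ' z => ?_⟩
  · have e : (1 / 2 : ℂ) * (1 - 1 / 2) = 1 / 4 := by norm_num
    rw [e]
    exact heig z
  · obtain ⟨γ, hγ, rfl⟩ := Subgroup.mem_map.1 hγ'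
    exact hinv γ hγ z

/-! ## §2 The slash action at `s = 1/2` -/

/-- `slashHalf γ φ t = (φ |_{1/2} γ)(t)` for the image of `γ` in `GL₂(ℝ)`. [cite: BruggemanLewisZagier2015, (2.1) p. 11] -/
theorem lineSlash_half_mapGL (γ : SL(2, ℤ)) (φ : ℝ → ℂ) (t : ℝ) :
    lineSlash (1 / 2) (Matrix.SpecialLinearGroup.mapGL ℝ γ) φ t =
      ((|((γ : Matrix (Fin 2) (Fin 2) ℤ) 1 0 : ℝ) * t + ((γ : Matrix (Fin 2) (Fin 2) ℤ) 1 1 : ℝ)|⁻¹ : ℝ) : ℂ) *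
        φ ((((γ : Matrix (Fin 2) (Fin 2) ℤ) 0 0 : ℝ) * t + ((γ : Matrix (Fin 2) (Fin 2) ℤ) 0 1 : ℝ)) /
          (((γ : Matrix (Fin 2) (Fin 2) ℤ) 1 0 : ℝ) * t + ((γ : Matrix (Fin 2) (Fin 2) ℤ) 1 1 : ℝ))) := by
  rw [lineSlash_one_half]
  rfl

/-! ## §3 The cocycle: the route's segment integral is `lewisZagierCocycle (1/2) i` -/

/-- On the open upper half-plane the kernel `R(t;·)^{1/2}` is the real function `√(Im w)/‖w - t‖`, so its real
Fréchet derivative there is the (complexified) derivative of that real function. [folklore] -/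
theorem fderiv_hypPoissonKernelCpow_half {t : ℝ} {w : ℂ} (hw : 0 < w.im) (v : ℂ) :
    fderiv ℝ (hypPoissonKernelCpow (1 / 2) t) w v =
      ((fderiv ℝ (fun x : ℂ => Real.sqrt x.im / ‖x - (t : ℂ)‖) w v : ℝ) : ℂ) := by
  have hev : hypPoissonKernelCpow (1 / 2) t =ᶠ[𝓝 w]
      fun x : ℂ => ((Real.sqrt x.im / ‖x - (t : ℂ)‖ : ℝ) : ℂ) := by
    filter_upwards [(isOpen_lt continuous_const Complex.continuous_im).mem_nhds hw] with x hx
    exact hypPoissonKernelCpow_one_half (le_of_lt hx)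
  rw [hev.fderiv_eq]
  by_cases hK : DifferentiableAt ℝ (fun x : ℂ => Real.sqrt x.im / ‖x - (t : ℂ)‖) w
  · have hcomp : (fun x : ℂ => ((Real.sqrt x.im / ‖x - (t : ℂ)‖ : ℝ) : ℂ)) =
        (Complex.ofRealCLM : ℝ → ℂ) ∘ fun x : ℂ => Real.sqrt x.im / ‖x - (t : ℂ)‖ := by
      funext x
      simp
    rw [hcomp, fderiv_comp w Complex.ofRealCLM.differentiableAt hK, ContinuousLinearMap.fderiv]
    simp
  · have hK' : ¬ DifferentiableAt ℝ (fun x : ℂ => ((Real.sqrt x.im / ‖x - (t : ℂ)‖ : ℝ) : ℂ)) w := by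
      intro h
      apply hK
      have h2 := Complex.reCLM.differentiableAt.comp w h
      have e : (Complex.reCLM : ℂ → ℝ) ∘ (fun x : ℂ => ((Real.sqrt x.im / ‖x - (t : ℂ)‖ : ℝ) : ℂ)) =
          fun x : ℂ => Real.sqrt x.im / ‖x - (t : ℂ)‖ := by
        funext x
        simp
      rwa [e] at h2
    rw [fderiv_zero_of_not_differentiableAt hK, fderiv_zero_of_not_differentiableAt hK']
    simp

/-- The base point: `γ⁻¹ i` for the `SL₂(ℤ)`-action is `(mapGL ℝ γ)⁻¹ i`. [folklore] -/
theorem sl_inv_smul_I_eq (γ : SL(2, ℤ)) :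
    (γ⁻¹ • UpperHalfPlane.I : UpperHalfPlane) =
      (Matrix.SpecialLinearGroup.mapGL ℝ γ : GL (Fin 2) ℝ)⁻¹ • UpperHalfPlane.I := by
  rw [sl_smul_eq_mapGL_smul, map_inv]

/-- The segment `w(τ) = (1-τ)·a + τ·i`, `τ ∈ [0,1]`, `a ∈ ℍ`, lies in `ℍ`. [folklore] -/
theorem segment_im_pos (a : UpperHalfPlane) {τ : ℝ} (hτ : τ ∈ Set.uIcc (0 : ℝ) 1) :
    0 < ((1 - (τ : ℂ)) * (a : ℂ) + (τ : ℂ) * Complex.I).im := by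
  rw [Set.uIcc_of_le zero_le_one] at hτ
  obtain ⟨h0, h1⟩ := hτ
  have ha : 0 < (a : ℂ).im := by rw [UpperHalfPlane.coe_im]; exact a.im_pos
  have him : ((1 - (τ : ℂ)) * (a : ℂ) + (τ : ℂ) * Complex.I).im = (1 - τ) * (a : ℂ).im + τ := by
    simp [Complex.add_im, Complex.mul_im, Complex.sub_re, Complex.sub_im]
  rw [him]
  rcases eq_or_lt_of_le h0 with h | h
  · subst h; simpa using ha
  · nlinarith [mul_nonneg (sub_nonneg.2 h1) ha.le]

/-- **The route's cocycle is the BLZ period cocycle at `s = 1/2`, base point `i`:**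
`lzCocycle u γ t = r_γ(t) = ∫_{γ⁻¹ i}^{i} [u, R(t;·)^{1/2}]`. The integrands agree pointwise on `τ ∈ [0,1]`.
[cite: BruggemanLewisZagier2015, (5.5a) p. 29] -/
theorem lzCocycle_eq_lewisZagierCocycle (u : UpperHalfPlane → ℂ) (γ : SL(2, ℤ)) (t : ℝ) :
    (∫ τ in (0 : ℝ)..1, (let w : ℂ := (1 - (τ : ℂ)) * ((γ⁻¹ • UpperHalfPlane.I : UpperHalfPlane) : ℂ) + (τ : ℂ) * Complex.I; let dw : ℂ := Complex.I - ((γ⁻¹ • UpperHalfPlane.I : UpperHalfPlane) : ℂ); (fderiv ℝ (u ∘ UpperHalfPlane.ofComplex) w 1 - Complex.I * fderiv ℝ (u ∘ UpperHalfPlane.ofComplex) w Complex.I) / 2 * ((Real.sqrt w.im / ‖w - (t : ℂ)‖ : ℝ) : ℂ) * dw + (u ∘ UpperHalfPlane.ofComplex) w * (((fderiv ℝ (fun x : ℂ => Real.sqrt x.im / ‖x - (t : ℂ)‖) w 1 : ℝ) + Complex.I * (fderiv ℝ (fun x : ℂ => Real.sqrt x.im / ‖x - (t : ℂ)‖) w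 Complex.I : ℝ)) / 2) * (starRingEnd ℂ) dw)) =
      lewisZagierCocycle (1 / 2) UpperHalfPlane.I u (Matrix.SpecialLinearGroup.mapGL ℝ γ) t := by
  rw [lewisZagierCocycle_apply, UpperHalfPlane.coe_I, ← sl_inv_smul_I_eq]
  apply intervalIntegral.integral_congr
  intro τ hτ
  have hw := segment_im_pos (γ⁻¹ • UpperHalfPlane.I) hτ
  dsimp only
  rw [greenForm, wirtingerDz, wirtingerDzbar, hypPoissonKernelCpow_one_half hw.le,
    fderiv_hypPoissonKernelCpow_half hw 1, fderiv_hypPoissonKernelCpow_half hw Complex.I]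

/-! ## §4 The crux from the BLZ facts -/

/-- **`PeriodClassNontrivialQuarter` from the three BLZ named facts** (each proved in the tree):
bridge §1–§3 + `eq_zero_of_lewisZagierCocycle_semiAnalytic_coboundary`.
[cite: BruggemanLewisZagier2015, Proposition 5.1 p. 30 and §13.1 p. 83] -/
theorem periodClassNontrivialQuarter_of_BLZ
    (hB : BruggemanLewisZagier2015_cocycle_analytic) (hA : BruggemanLewisZagier2015_prop_5_1)
    (hC : BruggemanLewisZagier2015_singularities_invariants) :
    Summit.Langlands.Langlands.Theses.RationalPeriodQuarter.PeriodClassNontrivialQuarter := by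
  intro N hN u hu hcob z
  obtain ⟨hC2, hinv, heig, _hbd⟩ := hu
  obtain ⟨f, hf, hcob⟩ := hcob
  have hu' := isInvariantEigenfunction_half_of_quarter hC2 hinv heig
  refine eq_zero_of_lewisZagierCocycle_semiAnalytic_coboundary hB hA hC (hasDetOne_Gamma1 N)
    (discreteTopology_Gamma1 hN) (hasInfiniteBoundaryOrbits_Gamma1 hN) (s := 1 / 2) (by norm_num) (by norm_num)
    hu' UpperHalfPlane.I ⟨f, hf, fun γ' hγ' => ?_⟩ z
  obtain ⟨γ, hγ, rfl⟩ := Subgroup.mem_map.1 hγ'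
  filter_upwards [hcob γ hγ] with t ht
  rw [← lzCocycle_eq_lewisZagierCocycle, lineSlash_half_mapGL]
  exact ht

/-- **Piece A of the g39 node from the first fact alone:** the typed cocycle of a quarter cusp form is real-analytic
on `ℝ` (`r_γ ∈ V_{1/2}^ω`, p. 29). [cite: BruggemanLewisZagier2015, (5.5a) p. 29] -/
theorem cocycleAnalyticity_of_BLZ (hB : BruggemanLewisZagier2015_cocycle_analytic) :
    (let IsQuarterCuspForm : ℕ → (UpperHalfPlane → ℂ) → Prop := fun N u => Literature.NumberTheory.Automorphic.IsC2 u ∧ (∀ γ ∈ CongruenceSubgroup.Gamma1 N, ∀ z : UpperHalfPlane, u (γ • z) = u z) ∧ (∀ z : UpperHalfPlane, Literature.NumberTheory.Automorphic.hypLaplacian u z + (1 / 4 : ℂ) * u z = 0) ∧ ∃ C : ℝ, ∀ z : UpperHalfPlane, ‖u z‖ ≤ C; let lzCocycle : (UpperHalfPlane → ℂ) → Matrix.SpecialLinearGroup (Fin 2) ℤ → ℝ → ℂ := fun u γ t => ∫ τ in (0 : ℝ)..1, (let w : ℂ := (1 - (τ : ℂ)) * ((γ⁻¹ • UpperHalfPlane.I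 : UpperHalfPlane) : ℂ) + (τ : ℂ) * Complex.I; let dw : ℂ := Complex.I - ((γ⁻¹ • UpperHalfPlane.I : UpperHalfPlane) : ℂ); (fderiv ℝ (u ∘ UpperHalfPlane.ofComplex) w 1 - Complex.I * fderiv ℝ (u ∘ UpperHalfPlane.ofComplex) w Complex.I) / 2 * ((Real.sqrt w.im / ‖w - (t : ℂ)‖ : ℝ) : ℂ) * dw + (u ∘ UpperHalfPlane.ofComplex) w * (((fderiv ℝ (fun x : ℂ => Real.sqrt x.im / ‖x - (t : ℂ)‖) w 1 : ℝ) + Complex.I * (fderiv ℝ (fun x : ℂ => Real.sqrt x.im / ‖x - (t : ℂ)‖) w Complex.I : ℝ)) / 2) * (starRingEnd ℂ) dw); ∀ N : ℕ, 0 < N → ∀ u : UpperHalfPlane → ℂ, IsQuarterCuspForm N u → ∀ γ ∈ CongruenceSubgroup.Gamma1 N, AnalyticOnNhd ℝ (lzCocycle u γ) Set.univ) := by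
  intro IsQuarterCuspForm lzCocycle N hN u hu γ hγ
  obtain ⟨hC2, hinv, heig, _hbd⟩ := hu
  have hu' := isInvariantEigenfunction_half_of_quarter hC2 hinv heig
  have hA := (hB _ (hasDetOne_Gamma1 N) (1 / 2) (by norm_num) (by norm_num) u hu' UpperHalfPlane.I
    (Matrix.SpecialLinearGroup.mapGL ℝ γ) (Subgroup.mem_map_of_mem _ hγ)).1
  have e : lzCocycle u γ = lewisZagierCocycle (1 / 2) UpperHalfPlane.I u (Matrix.SpecialLinearGroup.mapGL ℝ γ) := by
    funext t
    exact lzCocycle_eq_lewisZagierCocycle u γ t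
  rw [e]
  exact hA

end Summit.Langlands.Langlands.Theorems
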